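import Summits.BirchSwinnertonDyer.BirchSwinnertonDyer.Theses.SylvesterTwoHeegnerIndex
import Summits.BirchSwinnertonDyer.BirchSwinnertonDyer.Theorems.SylvesterTwoHeegnerIndexFrameConstants
import Literature.NumberTheory.EllipticCurves.QuadraticTwistRank
import Literature.NumberTheory.QuadraticFields.SquareRootGenerator
import HarnessLib

/-!
# Route `SylvesterTwoHeegnerIndex` (rung K7t), cruxes 19229/19230: the halvability flag is `k = 1`
# in EVERY Heegner frame of every member of 𝒞_HSY

HONEST FRAMING (cell «bsd-cm», seat `bsd-cm-two` g4; memo `pub/bsd-cm/MEMO-bsd-cm-two.md` v2.6 §33.1 (d)).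
Both K7t cruxes `HeegnerIndexUpperAtTwoHSY` / `HeegnerIndexLowerAtTwoHSY` quantify over a flag
`k ∈ {1, 2}` with `k = 2 ↔ (every y ∈ E(ℚ) is ≡ 2Q mod torsion for some Q ∈ E(K′))`, and `k²` divides the
`L`-free quotient `𝔮 = P2.cmHeegnerIndexQuotient`. This file proves that on 𝒞_HSY the flag is ALWAYS `1`:

* `finrank_eq_zero_of_forall_exists_two_nsmul` — a finitely generated `ℤ`-module in which every element is
  twice another has rank `0` (Noetherian chain `ℤy₀ ⊊ ℤy₁ ⊊ …` with `y_n = 2y_{n+1}`);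
* `exists_incl_eq_of_conjMap_eq` — over a quadratic extension `K = F(θ)`, a point of `V(K)` fixed by the
  conjugation comes from `V(F)` (generic-model version of the tree's `mem_range_incl_of_conjMap_eq`);
* `exists_eq_two_nsmul_of_incl_sub_two_zsmul_mem_torsion` — if `E(K′)` has no point of order `2` and
  `ι y − 2Q` is torsion, then `y ∈ 2E(ℚ)` (odd-order torsion, Galois descent `σQ′ = Q′ ⇒ Q′ ∈ ι E(ℚ)`);
* `halvabilityFlag_eq_one` — hence `k = 1` as soon as `rank E(ℚ) ≠ 0` and `E(K′)[2] = 0`;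
* `halvabilityFlag_eq_one_of_model` / `…_of_facts` — for every model `W` of `E_p` (`p` an odd prime; x1b's
  `SylvesterTwoFrame.two_torsion_eq_zero_of_model_of_finrank_eq_two` gives `E_p(K′)[2] = 0` over every
  quadratic field) with `rank ≠ 0`, resp. with `r_an = 1` and the route's `PublishedFactsTwo` (GZK).

Nothing is booked; the cruxes stay OPEN; this removes one variable (`k`) from both of them.
References: [SilvermanAEC2009] VIII (Mordell–Weil), Exercise 10.16; [GrossZagier1986] V.§2 (the flag in the
index formula); memo v2.6 §33.1 (d).
-/

set_option autoImplicit false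
set_option linter.dupNamespace false

noncomputable section

open scoped Classical

namespace Summit.BirchSwinnertonDyer.BirchSwinnertonDyer.Theorems.SylvesterTwoHalvability

open WeierstrassCurve Literature.NumberTheory.EllipticCurves Literature.NumberTheory.QuadraticFields

/-! ## §1 A finitely generated abelian group that is `2`-divisible on itself has rank `0` -/

/-- If every element of a finitely generated `ℤ`-module `G` is of the form `2 • z`, then `finrank ℤ G = 0`:
otherwise a non-torsion `y₀ = 2y₁ = 4y₂ = …` gives the chain `ℤy₀ ≤ ℤy₁ ≤ …`, which stabilises
(Noetherian), forcing `(1 − 2a)•y_{N+1} = 0` for some `a ∈ ℤ`, hence `(1 − 2a)•y₀ = 0`, contradiction.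
[folklore] -/
theorem finrank_eq_zero_of_forall_exists_two_nsmul {G : Type*} [AddCommGroup G] [Module.Finite ℤ G]
    (h : ∀ y : G, ∃ z : G, y = 2 • z) : Module.finrank ℤ G = 0 := by
  by_contra hr
  have hnt : ¬ Module.IsTorsion ℤ G := fun ht => hr (Module.finrank_eq_zero_iff_isTorsion.mpr ht)
  obtain ⟨y₀, hy₀⟩ : ∃ y₀ : G, ∀ a : nonZeroDivisors ℤ, (a : ℤ) • y₀ ≠ 0 := by
    by_contra hc
    refine hnt fun x => ?_
    by_contra hx
    exact hc ⟨x, fun a ha => hx ⟨a, ha⟩⟩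
  choose f hf using h
  -- the halving sequence `y_n` with `y_n = 2 • y_{n+1}`
  let seq : ℕ → G := fun n => f^[n] y₀
  have hseq : ∀ n, seq n = 2 • seq (n + 1) := fun n => by
    show f^[n] y₀ = 2 • f^[n + 1] y₀
    rw [Function.iterate_succ_apply']
    exact hf _
  have hpow : ∀ n, y₀ = 2 ^ n • seq n := by
    intro n
    induction n with
    | zero => simp [seq]
    | succ n ih => rw [ih, hseq n, ← mul_nsmul, ← pow_succ']
  -- the ascending chain of cyclic submodules
  have hmono : Monotone fun n => Submodule.span ℤ ({seq n} : Set G) := by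
    refine monotone_nat_of_le_succ fun n => ?_
    rw [Submodule.span_singleton_le_iff_mem, hseq n]
    exact nsmul_mem (Submodule.mem_span_singleton_self _) 2
  obtain ⟨N, hN⟩ := (monotone_stabilizes_iff_noetherian.mpr (inferInstance : IsNoetherian ℤ G))
    ⟨fun n => Submodule.span ℤ ({seq n} : Set G), hmono⟩
  have hmem : seq (N + 1) ∈ Submodule.span ℤ ({seq N} : Set G) := by
    have hNN : Submodule.span ℤ ({seq N} : Set G) = Submodule.span ℤ ({seq (N + 1)} : Set G) :=
      hN (N + 1) (Nat.le_succ N)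
    rw [hNN]
    exact Submodule.mem_span_singleton_self _
  obtain ⟨a, ha⟩ := Submodule.mem_span_singleton.mp hmem
  -- `(1 - 2a) • y_{N+1} = 0`
  have hkill : (1 - 2 * a : ℤ) • seq (N + 1) = 0 := by
    have hx : a • (seq (N + 1) + seq (N + 1)) = seq (N + 1) := by rw [← two_nsmul, ← hseq N]; exact ha
    rw [sub_smul, one_smul, sub_eq_zero, mul_comm, mul_smul, two_zsmul, hx]
  have hy : (1 - 2 * a : ℤ) • y₀ = 0 := by
    rw [hpow (N + 1), smul_comm, hkill, smul_zero]
  exact hy₀ ⟨1 - 2 * a, mem_nonZeroDivisors_of_ne_zero (by omega)⟩ hy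

/-! ## §2 Galois descent for points over a quadratic field, generic model -/

/-- **`σ`-fixed points of `V(K)` come from `V(F)`** for ANY Weierstrass model `V/F` and `K = F(θ)`,
`θ² = c ∈ F`, `θ ∉ F`, `2 ≠ 0`: both coordinates are `σ`-fixed, hence in `F`
(`Quadratic.exists_eq_algebraMap_of_conj_eq`). Generic-model version of the tree's
`WeierstrassCurve.QuadraticDescent.mem_range_incl_of_conjMap_eq` (stated there for `W^{(1)}`).
[cite: SilvermanAEC2009, Exercise 10.16] -/
theorem exists_incl_eq_of_conjMap_eq {F : Type*} {K : Type*} [Field F] [Field K] [Algebra F K]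
    [NeZero (2 : F)] (h2 : Module.finrank F K = 2) {θ : K} {c : F}
    (hθ : θ ∉ Set.range (algebraMap F K)) (hc : θ ^ 2 = algebraMap F K c)
    (V : WeierstrassCurve F) (P : (V.baseChange K).toAffine.Point)
    (hP : QuadraticDescent.conjMap V (Quadratic.conj h2 hθ hc) P = P) :
    ∃ Q : V.toAffine.Point, QuadraticDescent.incl K V Q = P := by
  rcases P with _ | ⟨x, y, h⟩
  · exact ⟨0, by rw [map_zero]; rfl⟩
  · rw [Affine.Point.map_some, Affine.Point.some.injEq] at hP
    obtain ⟨a, ha⟩ := Quadratic.exists_eq_algebraMap_of_conj_eq h2 hθ hc hP.1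
    obtain ⟨b, hb⟩ := Quadratic.exists_eq_algebraMap_of_conj_eq h2 hθ hc hP.2
    exact QuadraticDescent.exists_incl_eq (K := K) V h ha.symm hb.symm

/-- **`ι y − 2Q` torsion and `E(K′)[2] = 0` ⇒ `y ∈ 2E(F)`** (`K′/F` quadratic, `char F ≠ 2`, `W` any model over `F`).
The torsion point `T = ι y − 2Q` has ODD order `n` (an even order would produce a point of order `2`), so
`ι(n y) = 2(nQ)`; then `2(σ(nQ) − nQ) = 0` for the conjugation `σ`, so `σ` fixes `nQ`, which therefore is
`ι q′` with `q′ ∈ E(F)` (`exists_incl_eq_of_conjMap_eq`), and `2q′ = n y`; finally `y = n y − (n−1) y` with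
`n − 1` even. [cite: SilvermanAEC2009, Exercise 10.16] -/
theorem exists_eq_two_nsmul_of_incl_sub_two_zsmul_mem_torsion {F : Type*} [Field F] [NeZero (2 : F)]
    (W : WeierstrassCurve F) (K : Type*) [Field K] [Algebra F K] (hK2 : Module.finrank F K = 2)
    (h2 : ∀ Q : (W.baseChange K).toAffine.Point, 2 • Q = 0 → Q = 0)
    (y : W.toAffine.Point) (Q : (W.baseChange K).toAffine.Point)
    (hQ : QuadraticDescent.incl K W y - (2 : ℤ) • Q ∈
      AddCommGroup.torsion (W.baseChange K).toAffine.Point) :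
    ∃ q : W.toAffine.Point, y = 2 • q := by
  obtain ⟨θ, c, hθ, hc⟩ := Quadratic.exists_sq_eq_algebraMap (F := F) (K := K) hK2
  set T : (W.baseChange K).toAffine.Point := QuadraticDescent.incl K W y - (2 : ℤ) • Q with hT
  have hfin : IsOfFinAddOrder T := hQ
  set n : ℕ := addOrderOf T with hn
  have hnpos : 0 < n := hfin.addOrderOf_pos
  have hnT : n • T = 0 := addOrderOf_nsmul_eq_zero T
  -- `n` is odd
  have hnodd : Odd n := by
    by_contra hev
    rw [Nat.not_odd_iff_even] at hev
    obtain ⟨m, hm⟩ := hev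
    have hm2 : 2 • (m • T) = 0 := by rw [← mul_nsmul, mul_two, ← hm]; exact hnT
    have hmT : m • T = 0 := h2 _ hm2
    have hmpos : 0 < m := by omega
    have hmlt : m < addOrderOf T := by rw [← hn]; omega
    exact nsmul_ne_zero_of_lt_addOrderOf hmpos.ne' hmlt hmT
  -- `2 • (n • Q) = ι (n • y)`
  have h2z : ((2 : ℤ) • Q) = 2 • Q := by norm_cast
  have hQ' : 2 • (n • Q) = QuadraticDescent.incl K W (n • y) := by
    have h0 : n • T = 0 := hnT
    rw [hT, h2z, nsmul_sub, sub_eq_zero, ← map_nsmul] at h0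
    rw [smul_comm, ← h0]
  -- the conjugation fixes `n • Q`
  have hfix : QuadraticDescent.conjMap W (Quadratic.conj hK2 hθ hc) (n • Q) = n • Q := by
    have h0 : 2 • (QuadraticDescent.conjMap W (Quadratic.conj hK2 hθ hc) (n • Q) - n • Q) = 0 := by
      rw [smul_sub, ← map_nsmul, hQ', QuadraticDescent.conjMap_incl, sub_self]
    exact sub_eq_zero.mp (h2 _ h0)
  obtain ⟨q', hq'⟩ := exists_incl_eq_of_conjMap_eq hK2 hθ hc W (n • Q) hfix
  -- `2 • q' = n • y` in `E(F)`
  have h2q : 2 • q' = n • y := by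
    apply QuadraticDescent.incl_injective (K := K) W
    rw [map_nsmul, hq', hQ']
  -- `y = n • y - (n - 1) • y`, `n - 1 = 2m`
  obtain ⟨m, hm⟩ := hnodd
  refine ⟨q' - m • y, ?_⟩
  rw [nsmul_sub, h2q, hm, ← mul_nsmul', add_nsmul, one_nsmul, add_sub_cancel_left]

/-! ## §3 The halvability flag -/

/-- **`k = 1`**: for any Weierstrass curve `W/F` (`char F ≠ 2`) with `E(F)` finitely generated of nonzero rank and
any quadratic extension `K′/F` over which `W` has no point of order `2`, the flag `k ∈ {1,2}` with
`k = 2 ↔ ∀ y ∈ E(ℚ), ∃ Q ∈ E(K′), ι y − 2Q ∈ E(K′)_tors` equals `1` — else every `y ∈ E(ℚ)` would lie in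
`2E(F)` (`exists_eq_two_nsmul_of_incl_sub_two_zsmul_mem_torsion`), forcing rank `0`
(`finrank_eq_zero_of_forall_exists_two_nsmul`).
[cite: GrossZagier1986, V.§2 (2.2)] -/
theorem halvabilityFlag_eq_one {F : Type*} [Field F] [NeZero (2 : F)] (W : WeierstrassCurve F)
    (K : Type*) [Field K] [Algebra F K] (hK2 : Module.finrank F K = 2)
    (h2 : ∀ Q : (W.baseChange K).toAffine.Point, 2 • Q = 0 → Q = 0)
    [Module.Finite ℤ W.toAffine.Point] (hrank : Module.finrank ℤ W.toAffine.Point ≠ 0)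
    {k : ℕ} (hk : k = 1 ∨ k = 2)
    (hkiff : k = 2 ↔ ∀ y : W.toAffine.Point, ∃ Q : (W.baseChange K).toAffine.Point,
      QuadraticDescent.incl K W y - (2 : ℤ) • Q ∈ AddCommGroup.torsion (W.baseChange K).toAffine.Point) :
    k = 1 := by
  rcases hk with rfl | rfl
  · rfl
  · exfalso
    have H := hkiff.mp rfl
    refine hrank (finrank_eq_zero_of_forall_exists_two_nsmul fun y => ?_)
    obtain ⟨Q, hQ⟩ := H y
    exact exists_eq_two_nsmul_of_incl_sub_two_zsmul_mem_torsion W K hK2 h2 y Q hQ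

/-! ## §4 On 𝒞_HSY: every model of `E_p`, every (imaginary) quadratic `K′` -/

/-- **`k = 1` for every model of `E_p` over every quadratic field**, given `rank E_p(ℚ) ≠ 0`: the
`2`-torsion input is x1b's `SylvesterTwoFrame.two_torsion_eq_zero_of_model_of_finrank_eq_two`
(`E_p(K′)[2] = 0`, `p` odd). [cite: SilvermanAEC2009, Exercise 10.16] -/
theorem halvabilityFlag_eq_one_of_model {p : ℕ} (hp : p.Prime) (hp2 : p ≠ 2)
    (W : WeierstrassCurve ℚ) [W.IsElliptic]
    (hW : ∃ C : VariableChange ℚ, C • W = HuShuYin2019.cubeSumCurve (p : ℚ))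
    (K : Type) [Field K] [NumberField K] (hK2 : Module.finrank ℚ K = 2)
    (hrank : W.mordellWeilRank ≠ 0) {k : ℕ} (hk : k = 1 ∨ k = 2)
    (hkiff : k = 2 ↔ ∀ y : W.toAffine.Point, ∃ Q : (W.baseChange K).toAffine.Point,
      QuadraticDescent.incl K W y - (2 : ℤ) • Q ∈ AddCommGroup.torsion (W.baseChange K).toAffine.Point) :
    k = 1 := by
  haveI := W.module_finite_point_holds
  exact halvabilityFlag_eq_one W K hK2
    (fun Q hQ => SylvesterTwoFrame.two_torsion_eq_zero_of_model_of_finrank_eq_two K hK2 hp hp2 W hW Q hQ)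
    hrank hk hkiff

/-- **`k = 1` in every Heegner frame of the K7t cruxes** (binders of `HeegnerIndexUpper/LowerAtTwoHSY`:
`p ≡ 4, 7 (9)` prime, `W` a model of `E_p`, `K` imaginary quadratic, `r_an(W) = 1`), modulo the route's
support item `PublishedFactsTwo` — only its GZK conjunct `rank_eq_analyticRank_of_analyticRank_le_one` is
used, to turn `r_an = 1` into `rank = 1 ≠ 0`. [cite: GrossZagier1986, V.§2 (2.2)] -/
theorem halvabilityFlag_eq_one_of_facts
    (hF : Summit.BirchSwinnertonDyer.BirchSwinnertonDyer.Theses.SylvesterTwoHeegnerIndex.PublishedFactsTwo)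
    {p : ℕ} (hp : p.Prime) (h9 : p % 9 = 4 ∨ p % 9 = 7)
    (W : WeierstrassCurve ℚ) [W.IsElliptic]
    (hW : ∃ C : VariableChange ℚ, C • W = HuShuYin2019.cubeSumCurve (p : ℚ))
    (K : Type) [Field K] [NumberField K] (hK : IsImaginaryQuadratic K) (hr : W.analyticRank = 1)
    {k : ℕ} (hk : k = 1 ∨ k = 2)
    (hkiff : k = 2 ↔ ∀ y : W.toAffine.Point, ∃ Q : (W.baseChange K).toAffine.Point,
      QuadraticDescent.incl K W y - (2 : ℤ) • Q ∈ AddCommGroup.torsion (W.baseChange K).toAffine.Point) :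
    k = 1 := by
  have hGZK : rank_eq_analyticRank_of_analyticRank_le_one := hF.2.2.2.2.2.2.2.1
  have hrank : W.mordellWeilRank = W.analyticRank := (hGZK W (by rw [hr])).1
  exact halvabilityFlag_eq_one_of_model hp (SylvesterTwoLower.ne_two_of_mod_nine h9) W hW K hK.1
    (by rw [hrank, hr]; exact one_ne_zero) hk hkiff

end Summit.BirchSwinnertonDyer.BirchSwinnertonDyer.Theorems.SylvesterTwoHalvability

end
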